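import Literature.MathematicalPhysics.QuantumFieldTheory.Balaban1983to89.B9Eq3132KnitTestFamilyP2
import Literature.MathematicalPhysics.QuantumFieldTheory.Balaban1983to89.B9Eq3132TentLassos
import Literature.MathematicalPhysics.QuantumFieldTheory.Balaban1983to89.B9B8KnitLetterProjectionC
import Literature.MathematicalPhysics.QuantumFieldTheory.Balaban1983to89.B9Eq335ClassBridgePV1

/-!
# `Balaban1983to89.B9Eq3132KnitTestFamilyP1` — T. Bałaban, *Propagators and renormalization transformations for lattice gauge theories. II*, Commun. Math. Phys.
# **96** (1984) 223–250 [Balaban1984PropagatorsII], (2.147) p. 248 with [Balaban1985BackgroundPropagators] (3.26) p. 395, (3.115) p. 418, (3.132) p. 422, (3.35) p. 396, (3.69)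
# p. 404: (P′1) FOR PRINT's KNIT PAIR — the `Δ_a^Q(U)`-energy of the transported tent bumps at the knit averaging `Q(U) = QknitY U` and the knit site transporter
# `parKnitY` is bounded, `⟨T_θΦ, Δ_a^Q(U)T_θΦ⟩₁ ≤ C_K·‖Φ‖²`, uniformly in the member and in `U` on the class (3.35), under x-free numerics

statement-level skeleton of published theorems with citation tags; proofs where landed; nothing here is a claim about the Yang–Mills mass gap

THE PRINT.  [4] p. 248: *«The operator C is an inverse to the operator of the quadratic form (2.120), hence it is bounded from below by an inverse of an upper bound of this form …
(2.147)»*; [B9] p. 395 (3.26) *«Δ_a = Δ + DRD\* + Q\*aQ»* with print's `Q` = the composite averaging of (3.115) p. 418 and `R(U)` the orthogonal projection (3.20) p. 394 built on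
the knit contours; p. 404 (3.69) («Δ′ is a small perturbation of D\*D … from (3.35)»); p. 397 (3.40).

WHY THIS FILE (cell `pub-ymgap`, N06, seat `dag-n06-l` gen 38; road «P-Q26-knit» piece 7).  Row 26 at the knit pair (`Summit….N06Eq3132FromStateKnitQ.s3132_nu_knit_of_stepS_R`)
displays the test family's energy bound (P′1)ᴷ at `Δ x U = deltaAQY x 𝔮 𝔮s parKnitY (GpY parKnitY) U` (def-Y's (3.26) over the knit pair, KA's `hΔAK` letter).  n06-i's
`B9Eq3132EnergyOfTents.energy_tentOp_le` is (P′1) at the straight pair `(QY parBY, parSymY)`.  THE RE-PRESS: (§1) the form of def-Y's `deltaAQY` for ANY trace-adjoint pair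
`(𝔮, 𝔮⋆)` and ANY site transporter is `⟨A, Δ(U)A⟩₁ + ⟨D\*_UA, R(U)D\*_UA⟩₁ + ‖𝔮(U)A‖²_w` (the proof text of dag-n06-j's `B9Thm311ProjectionR.trIP_deltaAY_parSymY_eq` with the
adjointness displayed); at `parKnitY` the middle term is `≤ ‖D\*_UA‖²` by cell `lit-balaban` J-B's `B9B8KnitLetterProjectionC.trIP_RY_parKnitY_self(_le)` (the knit legs are
unitary on (3.35): this seat's F5 `B9Eq3124HZKnitPairReg335Y.parKnitY_mem_unitary_of_reg335P`, ambient `U(N)`); (§2) the knit averaging square on the tents splits as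
`‖Q(U)A‖²_w ≤ 2‖R_TQ_Y(U)A‖²_w + 2‖(Q − R_TQ_Y)(U)A‖²_w = 2‖Q_Y(U)A‖²_w + (knit error)` — n06-i's flat `Q`-term `B9Eq3132TentOverlap.trIP_QY_tentOp_le` plus
`B9Eq3132KnitTestFamilyP2.trIP_w_knitErr_tent_le`; (§3) the Hessian, curl, edge and divergence parts are n06-i's (`B9Eq3132EnergyUpper.trIP_hessY_le`, `B9Eq3132EnergyOfTents.curl_part_le ∕
edge_part_le ∕ div_part_le`) VERBATIM, under the same base-block smallness (hW)∕(hP); (§4) (hW)∕(hP) at a member from PRINT's class (3.35) (`bg9KP`, the knit regime's key) via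
dag-n06-j's bridge `B9Eq335ClassBridgePV1.reg335_of_reg335P` (`c′ = 10L³`) and n06-i's `lassoSmall_of_reg335 ∕ plaqSmall_of_reg335`, member-uniform below `M·α₀ ≤ aT`.

WHAT IS PROVED (sorry-free, 0 `def`).
* §1 ★ `trIP_deltaAQY_eq` ((3.26) as forms, generic pair and transporter), ★ `trIP_deltaAQY_parKnitY_le` (local upper form at the knit transporter).
* §2 ★ `trIP_w_QknitY_tent_le` (`‖Q(U)(T_θΦ)‖²_w ≤ (2C_Q + 2δ²·2(d+1)C_Θ)‖Φ‖²`).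
* §3 ★★★ `energy_knit_tentOp_le` — `⟨T_θΦ, Δ_a^Q(U)T_θΦ⟩₁ ≤ (C_{P1}(d,L,b₁,ω,ϖ) + C_Q(d,L,b₁) + 2δ²·2(d+1)C_Θ(d))·⟨Φ,Φ⟩₁` for `U ∈ (bg9KP … G i).Reg335 c₀ α₀` (`G ≤ U(N)`, `c₀ ≤ 10`,
  `0 ≤ Mα₀`) with (hW)∕(hP), knit numerics `0 < α₀′ ≤ α_Q`, `C₀α₀′ ≤ 1∕3`, `2α₀′ ≤ c₂′`, `K_pl(Mα₀)L⁴ < α₀′`, any `𝔮 U = QknitY U` with a trace-adjoint partner `𝔮⋆ U`;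
  `energy_knit_tentOp_rebase_le` (the same at the rebased amplitude `Φ = Ψ♭`, right side `‖Ψ‖²`).
* §4 ★ `baseSmall_of_reg335P` ((hW)∕(hP) with member-uniform `ω_K(aT), ϖ_K(aT)` from print's class at a member below `M·α₀ ≤ aT`).

HONEST SCOPE.  A composition of LANDED theorems by name with elementary form bookkeeping; the class (3.35) and the numerics are hypotheses; nothing of [B9]∕[4] newly asserted;
count-neutral; row 26 ∕ N06 NOT discharged; nothing continuum ∕ OS ∕ mass gap ∕ Clay.  NEW file.  No `sorry`, no `axiom`, no `instance`, no `notation`, no `def`.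
-/

noncomputable section

namespace Literature.MathematicalPhysics.QuantumFieldTheory.Balaban1983to89.B9Eq3132KnitTestFamilyP1

open Node00
open B6KLevelCensusIndexV1 (KIdx kGeo)
open B6GlobalChartV1 (PV)
open B9Thm311ReadingCoords (trIP IsAdjTr)
open B9Thm311DeltaPrimePos (trIP_self_nonneg trIP_add_right)
open B9Eq3132CoerciveVariational (trIP_comm)
open B9Thm311AdjointPairs (isAdjTr_gradY_divY)
open B9Thm311ProjectionR (trIP_aY_eq)
open B9B8KnitLetterProjectionC (trIP_RY_parKnitY_self trIP_RY_parKnitY_self_le)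
open B9Ineq369CurvatureSmallAtLettersY (hs_nonneg trIP_one_self_eq)
open B9Thm311PosOfPrincipalAtLettersY (norm_reHolY_sub_one_le)
open B9Eq3132EnergyUpper (trIP_hessY_le)
open B9Eq3132EnergyOfTents (BaseLassoSmall BasePlaqSmall curl_part_le div_part_le edge_part_le Cp1)
open B9Eq3132TentOverlap (trIP_QY_tentOp_le CQ)
open B9Eq3132TentKinetic (contractive_of_mem)
open B9Eq3132TentPlaquettes (varpi varpi_nonneg varpi_mono plaqSmall_of_reg335 basePlaqSmall_mono M_pos)
open B9Eq3132TentLassos (lassoSmall_of_reg335 baseLassoSmall_mono)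
open B6QGQCoerciveKLevelV1 (Cgrad)
open B9Eq39Adjoint (R)
open B9Eq3132NuReading (lamY lamInvY)
open B9Eq3132TentOperator (tentOp)
open B9Eq3132ApproxRightInverse (bumpProfile)
open B9Eq3132TentBumps (Cth)
open B9Eq3132KnitTentRebase (trIP_rowConj_self trIP_add_self_le)
open B9Eq3132KnitTestFamilyP2 (rebase_unit_mem trIP_rebase_self QknitY_split trIP_w_knitErr_tent_le)
open B9Eq3115KnitLetterY (QknitY zSrc)
open B9Eq3115KnitLetterYOnto (kCol kCol_nonneg)
open B9B8AveragingJunction (parKnitY)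
open B9Eq3124HZKnitPairReg335Y (parKnitY_mem_unitary_of_reg335P)
open B9Eq316AveragingTransposeZd (alphaQ)
open B9C2FormBoxRegimeY (Kpl)
open B9BackgroundsKLevelV1 (bg9K)
open B9BackgroundsKLevelV1P (bg9KP mem_of_reg335P)
open B9Eq335ClassBridgePV1 (reg335_of_reg335P)
open B7Prop2Explicit (C0 c2')
open scoped Matrix Matrix.Norms.L2Operator

variable {d ℓ : ℕ} {hd : 1 ≤ d + 1} {hL : Odd (ℓ + 1) ∧ 1 < ℓ + 1} {b₀ b₁ : ℝ} {N : ℕ}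
variable (i : KIdx d ℓ hd hL b₀ b₁) {G : Subgroup (Matrix (Fin N) (Fin N) ℂ)ˣ}

/-! ## §1 (3.26) as quadratic forms for a generic averaging pair and site transporter; the upper local form at the knit transporter -/

section Forms

/-- ★ **(3.26) AS QUADRATIC FORMS, GENERIC**: for a unitary-valued configuration, ANY pair `(𝔮, 𝔮⋆)` adjoint for the unit-weight trace pairings at `U`, ANY site transporter
`parS` and site letter `Gp`: `⟨A, Δ_a^𝔮(U)A⟩₁ = ⟨A, Δ(U)A⟩₁ + ⟨D\*_UA, R(U)D\*_UA⟩₁ + ‖𝔮(U)A‖²_w` ((3.8): `D` adjoint to `D\*`; the displayed adjointness for the last term).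
[cite: Balaban1985BackgroundPropagators, (3.26) p.395, (3.8) p.392, (3.13) p.393] -/
theorem trIP_deltaAQY_eq {U : CfgY (Matrix (Fin N) (Fin N) ℂ) i}
    (hU : ∀ μ x, ((U μ x : (Matrix (Fin N) (Fin N) ℂ)ˣ) : Matrix (Fin N) (Fin N) ℂ) ∈ unitary (Matrix (Fin N) (Fin N) ℂ))
    (𝔮 : CfgY (Matrix (Fin N) (Fin N) ℂ) i → ((FBondY i → Matrix (Fin N) (Fin N) ℂ) →ₗ[ℂ] (IBondY i → Matrix (Fin N) (Fin N) ℂ)))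
    (𝔮s : CfgY (Matrix (Fin N) (Fin N) ℂ) i → ((IBondY i → Matrix (Fin N) (Fin N) ℂ) →ₗ[ℂ] (FBondY i → Matrix (Fin N) (Fin N) ℂ)))
    (hQ : IsAdjTr (fun _ => (1 : ℝ)) (fun _ => (1 : ℝ)) (𝔮 U) (𝔮s U)) (parS : SiteParY (Matrix (Fin N) (Fin N) ℂ) i) (Gp : SiteOpY (Matrix (Fin N) (Fin N) ℂ) i)
    (A : FBondY i → Matrix (Fin N) (Fin N) ℂ) :
    trIP (fun _ => (1 : ℝ)) A (deltaAQY i 𝔮 𝔮s parS Gp U A)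
      = trIP (fun _ => (1 : ℝ)) A (hessY i U A) + trIP (fun _ => (1 : ℝ)) (divY i U A) (RY i parS Gp U (divY i U A)) + trIP i.w (𝔮 U A) (𝔮 U A) := by
  rw [deltaAQY, LinearMap.add_apply, LinearMap.add_apply, trIP_add_right, trIP_add_right]
  congr 1
  · congr 1
    rw [LinearMap.comp_apply, LinearMap.comp_apply, trIP_comm, isAdjTr_gradY_divY i U hU, trIP_comm]
  · rw [LinearMap.comp_apply, LinearMap.comp_apply, ← hQ, trIP_aY_eq]

/-- ★ **`Δ_a^𝔮(U)` AT THE KNIT TRANSPORTER FROM ABOVE, local form**: `G ≤ U(N)`, `U` `G`-valued, the knit legs `parKnitY U z w ∈ G`, `(𝔮, 𝔮⋆)` adjoint at `U` ⇒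
`⟨A, Δ_a^𝔮(U)A⟩₁ ≤ Σ_p (1 + |Re U(∂p) − 1|)·HS((D_UA)(p)) + 3c_f²Σ_p |Im U(∂p)|·Σ_m HS(A(b_m p)) + ⟨D\*_UA, D\*_UA⟩₁ + ‖𝔮(U)A‖²_w` (`R(U)` an orthogonal projection).
[cite: Balaban1985BackgroundPropagators, (3.26) p.395, (3.10) p.392, (3.69) p.404, (3.20) p.394, (3.25) p.394] -/
theorem trIP_deltaAQY_parKnitY_le (hG : G ≤ B7Prop2Explicit.unitaryUnits (Matrix (Fin N) (Fin N) ℂ)) {U : CfgY (Matrix (Fin N) (Fin N) ℂ) i} (hU : ∀ μ x, U μ x ∈ G)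
    (hpar : ∀ z w : SiteY i, parKnitY i U z w ∈ G)
    (𝔮 : CfgY (Matrix (Fin N) (Fin N) ℂ) i → ((FBondY i → Matrix (Fin N) (Fin N) ℂ) →ₗ[ℂ] (IBondY i → Matrix (Fin N) (Fin N) ℂ)))
    (𝔮s : CfgY (Matrix (Fin N) (Fin N) ℂ) i → ((IBondY i → Matrix (Fin N) (Fin N) ℂ) →ₗ[ℂ] (FBondY i → Matrix (Fin N) (Fin N) ℂ)))
    (hQ : IsAdjTr (fun _ => (1 : ℝ)) (fun _ => (1 : ℝ)) (𝔮 U) (𝔮s U)) (A : FBondY i → Matrix (Fin N) (Fin N) ℂ) :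
    trIP (fun _ => (1 : ℝ)) A (deltaAQY i 𝔮 𝔮s (parKnitY i) (GpY i (parKnitY i)) U A) ≤
      (∑ p : PlaqY i, (1 + ‖reHolY i U p - 1‖) * ∑ a, ∑ b, ‖curlY i U A p a b‖ ^ 2
        + 3 * ∑ p : PlaqY i, i.cf ^ 2 * ‖imHolY i U p‖ * ∑ m : Fin 4, ∑ a, ∑ b, ‖A (edgeY i p m) a b‖ ^ 2)
      + trIP (fun _ => (1 : ℝ)) (divY i U A) (divY i U A) + trIP i.w (𝔮 U A) (𝔮 U A) := by
  have hU' : ∀ μ x, ((U μ x : (Matrix (Fin N) (Fin N) ℂ)ˣ) : Matrix (Fin N) (Fin N) ℂ) ∈ unitary (Matrix (Fin N) (Fin N) ℂ) := fun μ x => hG (hU μ x)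
  rw [trIP_deltaAQY_eq i hU' 𝔮 𝔮s hQ (parKnitY i) (GpY i (parKnitY i)) A]
  have h1 := trIP_hessY_le i hU' A
  have h2 := trIP_RY_parKnitY_self_le i hG hU hpar (divY i U A)
  rw [← trIP_RY_parKnitY_self i hG hU hpar (divY i U A)] at h2
  linarith

end Forms

/-! ## §2 The knit averaging square on the tents -/

section QTerm

variable [Nonempty (Fin N)]

/-- ★ **THE KNIT AVERAGING SQUARE ON THE TENTS**: `‖Q(U)(T_θΦ)‖²_w ≤ (2C_Q(d,L,b₁) + 2δ²·2(d+1)C_Θ(d))·‖Φ‖²`, `δ² = (α₀′m₀)²·2Nb₁`, for every member background of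
`(bg9KP … G i).Reg335 c₀ α₀` (`G ≤ U(N)`, `c₀ ≤ 10`, `0 ≤ Mα₀`), numerics `0 < α₀′ ≤ α_Q`, `K_pl(Mα₀)L⁴ < α₀′`, `0 ≤ b₁`: split `Q = R_TQ_Y + (Q − R_TQ_Y)` row by row, the first
square is n06-i's flat `Q`-term (the row conjugations are isometries), the second the knit error. [cite: Balaban1985BackgroundPropagators, (3.115) p.418, (3.13) p.393, (3.35) p.396; Balaban1984PropagatorsII, (2.147) p.248, (2.16) p.225; Balaban1985Averaging, (139)–(147) pp.39–40] -/
theorem trIP_w_QknitY_tent_le (hGU : G ≤ B7Prop2Explicit.unitaryUnits (Matrix (Fin N) (Fin N) ℂ)) (hb₁ : 0 ≤ b₁)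
    {U : CfgY (Matrix (Fin N) (Fin N) ℂ) i} {c₀ α₀ : ℝ} (hc : c₀ ≤ 10) (hMα : 0 ≤ (kGeo i).M * α₀)
    (hreg : (bg9KP (Matrix (Fin N) (Fin N) ℂ) G i).Reg335 c₀ α₀ U) {α₀' : ℝ} (hα' : 0 < α₀') (hαQ : α₀' ≤ alphaQ (d + 1) (ℓ + 1))
    (hK : Kpl i ((kGeo i).M * α₀) * (kGeo i).L ^ 4 < α₀') (T : IBondY i → (Matrix (Fin N) (Fin N) ℂ)ˣ)
    (hT : ∀ ι, T ι = (parTaxiV U (B15DeterminingSets.embIter (ι.1.1 : ℕ) ι.1.2.src)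
      (B10Eq27TorusAxialLog.transl (0 : Site (PV d ℓ i.m i.K hd hL) 0) (B7Prop1Local.loK (ℓ + 1) (ι.1.1 : ℕ) (zSrc i ι))))⁻¹)
    (Φ : IBondY i → Matrix (Fin N) (Fin N) ℂ) :
    trIP i.w (QknitY i U (tentOp i (bumpProfile i) U Φ)) (QknitY i U (tentOp i (bumpProfile i) U Φ))
      ≤ (2 * CQ d ℓ b₁ + 2 * ((α₀' * (2 * ((d : ℝ) + 1) * kCol (d + 1) (ℓ + 1) + 8 * ((d : ℝ) + 2) ^ 2)) ^ 2 * (2 * (N : ℝ) * b₁)) * (2 * ((d : ℝ) + 1) * Cth d))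
          * trIP (fun _ => (1 : ℝ)) Φ Φ := by
  have hUu : ∀ μ x, U μ x ∈ B7Prop2Explicit.unitaryUnits (Matrix (Fin N) (Fin N) ℂ) := fun μ x => hGU (mem_of_reg335P (G := G) i hreg μ x)
  have hTu := fun ι => (rebase_unit_mem i hGU hreg T hT ι).1
  set A := tentOp i (bumpProfile i) U Φ with hA
  rw [QknitY_split i T U A]
  have hsplit := trIP_add_self_le i.w i.hw (fun ι => R (T ι) (QY i (parBY i) U A ι)) (fun ι => QknitY i U A ι - R (T ι) (QY i (parBY i) U A ι))
  have hiso : trIP i.w (fun ι => R (T ι) (QY i (parBY i) U A ι)) (fun ι => R (T ι) (QY i (parBY i) U A ι)) = trIP i.w (QY i (parBY i) U A) (QY i (parBY i) U A) :=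
    trIP_rowConj_self i.w T hTu (QY i (parBY i) U A)
  have hflat := trIP_QY_tentOp_le i hUu hb₁ Φ
  have herr := trIP_w_knitErr_tent_le i hGU hb₁ hc hMα hreg hα' hαQ hK T hT Φ
  rw [hiso] at hsplit
  linarith

end QTerm

/-! ## §3 ★★★ (P′1) for the knit pair -/

section Energy

variable [Nonempty (Fin N)]

/-- ★★★ **(P′1)ᴷ — THE `Δ_a^Q(U)`-ENERGY OF THE TRANSPORTED TENT BUMPS AT PRINT's KNIT PAIR `(QknitY, parKnitY)` IS BOUNDED**: for `G ≤ U(N)`, a member background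
`U ∈ (bg9KP … G i).Reg335 c₀ α₀` (`c₀ ≤ 10`, `0 ≤ Mα₀`) whose taxicab lassos and plaquettes are small on the base blocks ((hW) `ω`, (hP) `ϖ ≥ 0`), knit numerics `0 < α₀′ ≤ α_Q`,
`C₀α₀′ ≤ 1∕3`, `2α₀′ ≤ c₂′`, `K_pl(Mα₀)L⁴ < α₀′`, `0 ≤ b₁`, any letter `𝔮 U = QknitY U` with a trace-adjoint partner `𝔮⋆ U`, and every `Φ`:
`⟨T_θΦ, Δ_a^𝔮(U; parKnitY, GpY parKnitY)T_θΦ⟩₁ ≤ (C_{P1}(d,L,b₁,ω,ϖ) + C_Q(d,L,b₁) + 2δ²·2(d+1)C_Θ(d))·⟨Φ,Φ⟩₁`, `δ² = (α₀′m₀)²·2Nb₁`.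
[cite: Balaban1984PropagatorsII, (2.147) p.248; Balaban1985BackgroundPropagators, (3.26) p.395, (3.115) p.418, (3.69) p.404, (3.35) p.396, (3.132) p.422; Balaban1985Averaging, Prop. 2 p.26, (139)–(147) pp.39–40] -/
theorem energy_knit_tentOp_le (hG : G ≤ B7Prop2Explicit.unitaryUnits (Matrix (Fin N) (Fin N) ℂ)) (hb₁ : 0 ≤ b₁)
    {U : CfgY (Matrix (Fin N) (Fin N) ℂ) i} {c₀ α₀ : ℝ} (hc : c₀ ≤ 10) (hMα : 0 ≤ (kGeo i).M * α₀)
    (hreg : (bg9KP (Matrix (Fin N) (Fin N) ℂ) G i).Reg335 c₀ α₀ U) {α₀' : ℝ} (hα' : 0 < α₀') (hαQ : α₀' ≤ alphaQ (d + 1) (ℓ + 1))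
    (hα3 : C0 (d + 1) * α₀' ≤ 1 / 3) (hα2 : 2 * α₀' ≤ c2' (d + 1) (ℓ + 1)) (hK : Kpl i ((kGeo i).M * α₀) * (kGeo i).L ^ 4 < α₀')
    {ω ϖ : ℝ} (hϖ : 0 ≤ ϖ) (hW : BaseLassoSmall i U ω) (hP : BasePlaqSmall i U ϖ) (T : IBondY i → (Matrix (Fin N) (Fin N) ℂ)ˣ)
    (hT : ∀ ι, T ι = (parTaxiV U (B15DeterminingSets.embIter (ι.1.1 : ℕ) ι.1.2.src)
      (B10Eq27TorusAxialLog.transl (0 : Site (PV d ℓ i.m i.K hd hL) 0) (B7Prop1Local.loK (ℓ + 1) (ι.1.1 : ℕ) (zSrc i ι))))⁻¹)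
    (𝔮 : CfgY (Matrix (Fin N) (Fin N) ℂ) i → ((FBondY i → Matrix (Fin N) (Fin N) ℂ) →ₗ[ℂ] (IBondY i → Matrix (Fin N) (Fin N) ℂ)))
    (𝔮s : CfgY (Matrix (Fin N) (Fin N) ℂ) i → ((IBondY i → Matrix (Fin N) (Fin N) ℂ) →ₗ[ℂ] (FBondY i → Matrix (Fin N) (Fin N) ℂ)))
    (h𝔮 : 𝔮 U = QknitY i U) (hQ : IsAdjTr (fun _ => (1 : ℝ)) (fun _ => (1 : ℝ)) (𝔮 U) (𝔮s U)) (Φ : IBondY i → Matrix (Fin N) (Fin N) ℂ) :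
    trIP (fun _ => (1 : ℝ)) (tentOp i (bumpProfile i) U Φ)
        (deltaAQY i 𝔮 𝔮s (parKnitY i) (GpY i (parKnitY i)) U (tentOp i (bumpProfile i) U Φ)) ≤
      (Cp1 d ℓ b₁ ω ϖ + CQ d ℓ b₁
        + 2 * ((α₀' * (2 * ((d : ℝ) + 1) * kCol (d + 1) (ℓ + 1) + 8 * ((d : ℝ) + 2) ^ 2)) ^ 2 * (2 * (N : ℝ) * b₁)) * (2 * ((d : ℝ) + 1) * Cth d))
        * trIP (fun _ => (1 : ℝ)) Φ Φ := by
  have hU : ∀ μ x, U μ x ∈ G := fun μ x => mem_of_reg335P (G := G) i hreg μ x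
  have hU' : ∀ μ x, U μ x ∈ B7Prop2Explicit.unitaryUnits (Matrix (Fin N) (Fin N) ℂ) := fun μ x => hG (hU μ x)
  have hUu : ∀ μ x, ((U μ x : (Matrix (Fin N) (Fin N) ℂ)ˣ) : Matrix (Fin N) (Fin N) ℂ) ∈ unitary (Matrix (Fin N) (Fin N) ℂ) := hU'
  have hG1 : ∀ u : (Matrix (Fin N) (Fin N) ℂ)ˣ, u ∈ G → ‖(u : Matrix (Fin N) (Fin N) ℂ)‖ ≤ 1 := fun u hu => (contractive_of_mem (hG hu)).1
  -- the knit legs are unitary on (3.35): the `R(U)`-term is read in the ambient `U(N)`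
  have hparU : ∀ z w : SiteY i, parKnitY i U z w ∈ B7Prop2Explicit.unitaryUnits (Matrix (Fin N) (Fin N) ℂ) :=
    fun z w => parKnitY_mem_unitary_of_reg335P i hG1 hG U hc hMα hreg hα' hα3 hα2 hK z w
  set A := tentOp i (bumpProfile i) U Φ with hA
  have h0 := trIP_deltaAQY_parKnitY_le i (G := B7Prop2Explicit.unitaryUnits (Matrix (Fin N) (Fin N) ℂ)) le_rfl hU' hparU 𝔮 𝔮s hQ A
  -- the Jordan weight is at most `3`
  have hJ : ∑ p : PlaqY i, (1 + ‖reHolY i U p - 1‖) * ∑ a, ∑ c, ‖curlY i U A p a c‖ ^ 2 ≤ 3 * ∑ p : PlaqY i, ∑ a, ∑ c, ‖curlY i U A p a c‖ ^ 2 := by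
    rw [Finset.mul_sum]
    refine Finset.sum_le_sum fun p _ => mul_le_mul_of_nonneg_right ?_ (hs_nonneg _)
    have h1 := (contractive_of_mem (B9Thm311AdjointPairs.holY_mem_unitary i U hUu p)).1
    have h2 := (contractive_of_mem (Subgroup.one_mem (B7Prop2Explicit.unitaryUnits (Matrix (Fin N) (Fin N) ℂ)))).1
    rw [Units.val_one] at h2
    have hc2 : ‖((holY i U p : (Matrix (Fin N) (Fin N) ℂ)ˣ) : Matrix (Fin N) (Fin N) ℂ) - 1‖ ≤ 2 := (norm_sub_le _ _).trans (by linarith)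
    linarith [norm_reHolY_sub_one_le i U hUu hc2]
  have h1 := curl_part_le i hG hU hW Φ
  have h2 := edge_part_le i hG hU hϖ hP Φ
  have h3 := div_part_le i hG hU hW Φ
  have h4 := trIP_w_QknitY_tent_le i hG hb₁ hc hMα hreg hα' hαQ hK T hT Φ
  rw [← h𝔮] at h4
  have hΦ : 0 ≤ trIP (fun _ => (1 : ℝ)) Φ Φ := trIP_self_nonneg _ (fun _ => one_pos) Φ
  rw [Cp1]
  nlinarith [hJ, h0]

/-- ★★★ **(P′1)ᴷ AT THE REBASED AMPLITUDE**: the same bound for `Φ = Ψ♭`, `Ψ♭(ι) = R(T_ι⁻¹)Ψ(ι)`, with right side `‖Ψ‖²` (the row units are unitary).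
[cite: Balaban1984PropagatorsII, (2.147) p.248; Balaban1985BackgroundPropagators, (3.26) p.395, (3.115) p.418, (3.35) p.396, (3.132) p.422] -/
theorem energy_knit_tentOp_rebase_le (hG : G ≤ B7Prop2Explicit.unitaryUnits (Matrix (Fin N) (Fin N) ℂ)) (hb₁ : 0 ≤ b₁)
    {U : CfgY (Matrix (Fin N) (Fin N) ℂ) i} {c₀ α₀ : ℝ} (hc : c₀ ≤ 10) (hMα : 0 ≤ (kGeo i).M * α₀)
    (hreg : (bg9KP (Matrix (Fin N) (Fin N) ℂ) G i).Reg335 c₀ α₀ U) {α₀' : ℝ} (hα' : 0 < α₀') (hαQ : α₀' ≤ alphaQ (d + 1) (ℓ + 1))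
    (hα3 : C0 (d + 1) * α₀' ≤ 1 / 3) (hα2 : 2 * α₀' ≤ c2' (d + 1) (ℓ + 1)) (hK : Kpl i ((kGeo i).M * α₀) * (kGeo i).L ^ 4 < α₀')
    {ω ϖ : ℝ} (hϖ : 0 ≤ ϖ) (hW : BaseLassoSmall i U ω) (hP : BasePlaqSmall i U ϖ) (T : IBondY i → (Matrix (Fin N) (Fin N) ℂ)ˣ)
    (hT : ∀ ι, T ι = (parTaxiV U (B15DeterminingSets.embIter (ι.1.1 : ℕ) ι.1.2.src)
      (B10Eq27TorusAxialLog.transl (0 : Site (PV d ℓ i.m i.K hd hL) 0) (B7Prop1Local.loK (ℓ + 1) (ι.1.1 : ℕ) (zSrc i ι))))⁻¹)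
    (𝔮 : CfgY (Matrix (Fin N) (Fin N) ℂ) i → ((FBondY i → Matrix (Fin N) (Fin N) ℂ) →ₗ[ℂ] (IBondY i → Matrix (Fin N) (Fin N) ℂ)))
    (𝔮s : CfgY (Matrix (Fin N) (Fin N) ℂ) i → ((IBondY i → Matrix (Fin N) (Fin N) ℂ) →ₗ[ℂ] (FBondY i → Matrix (Fin N) (Fin N) ℂ)))
    (h𝔮 : 𝔮 U = QknitY i U) (hQ : IsAdjTr (fun _ => (1 : ℝ)) (fun _ => (1 : ℝ)) (𝔮 U) (𝔮s U)) (Ψ : IBondY i → Matrix (Fin N) (Fin N) ℂ) :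
    trIP (fun _ => (1 : ℝ)) (tentOp i (bumpProfile i) U (fun ι => R (T ι)⁻¹ (Ψ ι)))
        (deltaAQY i 𝔮 𝔮s (parKnitY i) (GpY i (parKnitY i)) U (tentOp i (bumpProfile i) U (fun ι => R (T ι)⁻¹ (Ψ ι)))) ≤
      (Cp1 d ℓ b₁ ω ϖ + CQ d ℓ b₁
        + 2 * ((α₀' * (2 * ((d : ℝ) + 1) * kCol (d + 1) (ℓ + 1) + 8 * ((d : ℝ) + 2) ^ 2)) ^ 2 * (2 * (N : ℝ) * b₁)) * (2 * ((d : ℝ) + 1) * Cth d))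
        * trIP (fun _ => (1 : ℝ)) Ψ Ψ := by
  have h := energy_knit_tentOp_le i hG hb₁ hc hMα hreg hα' hαQ hα3 hα2 hK hϖ hW hP T hT 𝔮 𝔮s h𝔮 hQ (fun ι => R (T ι)⁻¹ (Ψ ι))
  rwa [trIP_rebase_self i T (fun ι => (rebase_unit_mem i hG hreg T hT ι).2) Ψ] at h

end Energy

/-! ## §4 (hW)∕(hP) at a member from print's class (3.35), member-uniform -/

section Member

open B9PinMembersKLevelV1 (MemberY geo9Y)

variable [Nonempty (Fin N)]

/-- ★ **(hW)∕(hP) FROM PRINT's CLASS (3.35) AT A MEMBER, member-uniform**: for `G ≤ U(N)`, a member `x`, `0 < α₀`, `M·α₀ ≤ aT` and `U ∈ (bg9KP … G x).Reg335 c₀ α₀` (`c₀ ≤ 10`):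
`BaseLassoSmall x U ω_K(aT)` and `BasePlaqSmall x U ϖ_K(aT)` with `ϖ_K(aT) = ϖ(10L³·aT)`, `ω_K(aT) = 2(d+1)L²·ϖ_K(aT)` — dag-n06-j's bridge to the small-cube class at `c′ = 10L³`
and n06-i's (hW)∕(hP). [cite: Balaban1985BackgroundPropagators, (3.35) p.396 («≧ 10»), (3.69) p.404, (3.40) p.397, p.409] -/
theorem baseSmall_of_reg335P (hG : G ≤ B7Prop2Explicit.unitaryUnits (Matrix (Fin N) (Fin N) ℂ)) {Mstar : ℕ} (x : MemberY d ℓ hd hL b₀ b₁ Mstar)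
    {c₀ α₀ aT : ℝ} (hc : c₀ ≤ 10) (hα : 0 < α₀) (hMa : (geo9Y x).M * α₀ ≤ aT) {U : CfgY (Matrix (Fin N) (Fin N) ℂ) x.toKIdx}
    (hreg : (bg9KP (Matrix (Fin N) (Fin N) ℂ) G x.toKIdx).Reg335 c₀ α₀ U) :
    BaseLassoSmall x.toKIdx U (2 * ((d : ℝ) + 1) * (((ℓ + 1 : ℕ) : ℝ)) ^ 2 * varpi (10 * (((ℓ + 1 : ℕ) : ℝ)) ^ 3 * aT)) ∧
      BasePlaqSmall x.toKIdx U (varpi (10 * (((ℓ + 1 : ℕ) : ℝ)) ^ 3 * aT)) := by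
  have hK : (bg9K (Matrix (Fin N) (Fin N) ℂ) G x.toKIdx).Reg335 (10 * (((ℓ + 1 : ℕ) : ℝ)) ^ 3) α₀ U :=
    reg335_of_reg335P x.toKIdx hc hα.le hreg le_rfl
  have hW := lassoSmall_of_reg335 x.toKIdx hG hK
  have hP := plaqSmall_of_reg335 x.toKIdx hK
  have hM : 0 ≤ (kGeo x.toKIdx).M := (M_pos x.toKIdx).le
  have hc' : (0 : ℝ) ≤ 10 * (((ℓ + 1 : ℕ) : ℝ)) ^ 3 := by positivity
  have hlo : 0 ≤ 10 * (((ℓ + 1 : ℕ) : ℝ)) ^ 3 * (kGeo x.toKIdx).M * α₀ := by positivity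
  have hle : 10 * (((ℓ + 1 : ℕ) : ℝ)) ^ 3 * (kGeo x.toKIdx).M * α₀ ≤ 10 * (((ℓ + 1 : ℕ) : ℝ)) ^ 3 * aT := by
    rw [mul_assoc]; exact mul_le_mul_of_nonneg_left hMa hc'
  have hmono := varpi_mono hlo hle
  exact ⟨baseLassoSmall_mono x.toKIdx hW (mul_le_mul_of_nonneg_left hmono (by positivity)), basePlaqSmall_mono x.toKIdx hP hmono⟩

end Member

end Literature.MathematicalPhysics.QuantumFieldTheory.Balaban1983to89.B9Eq3132KnitTestFamilyP1

end
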